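import Summits.Ventures.PercRepro.CoreFourCounts
import Summits.Ventures.PercRepro.RankLevelSetCocircuitCount

/-!
# PercRepro — circuits are unions of series classes; the small circuits by class sizes (p2, gen 12)

In a coloop-free matroid `M` the series classes are the parallel classes of `M✶`: `cls r = M✶.closure {r}`. Every
circuit of `M` (a cocircuit of `M✶`, whose complement is an `M✶`-flat) is a union of such classes, so with `R` a set of
representatives (`exists_parallel_reps M✶`) a circuit `C` is determined by `C ∩ R` and `|C| = Σ_{r ∈ C ∩ R} |cls r|`.
So `#{k-circuits} ≤ #{T ⊆ R : Σ_{r ∈ T} |cls r| = k}`, which `CoreFourWeights` bounds by the class sizes — the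
class-structure bounds of the all-dense case of the corank-`4` cells `p ∈ {9, 10}` (CoreFourSmall).

* `closure_dual_singleton_subset_of_mem_isCircuit` — a circuit contains the class of each of its elements;
* `cls_disjoint`, `ground_eq_biUnion_cls`, `ncard_ground_eq_sum` — the classes partition `E`, `|E| = Σ |cls r|`;
* `isCircuit_eq_biUnion_cls`, `ncard_isCircuit_eq_sum` — a circuit is the union of its classes, `|C| = Σ_{r ∈ C ∩ R} |cls r|`;
* `ncard_circuitsEq_le_card_weight` — `#{k-circuits} ≤ #{T ⊆ R : Σ_{r∈T} |cls r| = k}`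
  (the weight counts themselves are `CoreFourWeights`).
Imports `CoreFourCounts`, `RankLevelSetCocircuitCount`. Axioms: standard.
-/

namespace PercRepro
namespace CoreFour

open Set Finset

variable {α : Type} {M : Matroid α}

/-! ### Circuits are unions of series classes -/

/-- In a coloop-free matroid every element of `E` is a nonloop of the dual. -/
theorem dual_isNonloop_of_not_isColoop (hcoloop : ∀ e, ¬ M.IsColoop e) {e : α} (he : e ∈ M.E) :
    M✶.IsNonloop e := by
  rw [Matroid.isNonloop_iff]
  refine ⟨fun h => hcoloop e (Matroid.dual_isLoop_iff_isColoop.1 h), ?_⟩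
  rwa [Matroid.dual_ground]

/-- **A circuit contains the whole series class of each of its elements**: the complement of the circuit is a flat of
`M✶`; a class element outside the circuit would pull the element into that flat. -/
theorem closure_dual_singleton_subset_of_mem_isCircuit [M.Finite] (hcoloop : ∀ e, ¬ M.IsColoop e)
    {C : Set α} (hC : M.IsCircuit C) {x : α} (hx : x ∈ C) : M✶.closure {x} ⊆ C := by
  have hK : M✶.IsCocircuit C := Matroid.dual_isCocircuit_iff.2 hC
  have hflat := PercRepro.Matroid.IsCocircuit.closure_compl_eq hK
  intro y hy
  by_contra hyC
  have hyE : y ∈ M.E := by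
    have := M✶.closure_subset_ground {x} hy
    rwa [Matroid.dual_ground] at this
  have hynl : M✶.IsNonloop y := dual_isNonloop_of_not_isColoop hcoloop hyE
  have hcl : M✶.closure {y} = M✶.closure {x} := hynl.closure_eq_of_mem_closure hy
  have hyH : y ∈ M✶.E \ C := ⟨by rwa [Matroid.dual_ground], hyC⟩
  have hxH : x ∈ M✶.E \ C := by
    rw [← hflat]
    have h1 : x ∈ M✶.closure {x} := M✶.mem_closure_self x (by rw [Matroid.dual_ground]; exact hC.subset_ground hx)
    rw [← hcl] at h1
    exact M✶.closure_subset_closure (Set.singleton_subset_iff.2 hyH) h1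
  exact hxH.2 hx

/-! ### Representatives -/

/-- The data of a set of representatives of the series classes of `M` (parallel classes of `M✶`): `R ⊆ E`, every
element of `R` is a nonloop of `M✶`, every nonloop of `M✶` is parallel to some `r ∈ R`, and no two elements of `R`
are parallel (the hypotheses of `ncard_isCircuit_mul_choose_le`). -/
structure IsReps (M : Matroid α) (R : Set α) : Prop where
  subset : R ⊆ M.E
  nonloop : ∀ r ∈ R, M✶.IsNonloop r
  cover : ∀ e, M✶.IsNonloop e → ∃ r ∈ R, e ∈ M✶.closure {r}
  inj : ∀ r ∈ R, ∀ s ∈ R, r ∈ M✶.closure {s} → r = s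

/-- A set of representatives exists. -/
theorem exists_isReps (M : Matroid α) : ∃ R, IsReps M R := by
  obtain ⟨R, hR, hR0, hR1, hR2⟩ := PercRepro.Matroid.exists_parallel_reps M✶
  rw [Matroid.dual_ground] at hR
  exact ⟨R, hR, hR0, hR1, hR2⟩

/-- The class of `r` lies in `E`. -/
theorem cls_subset_ground (M : Matroid α) (r : α) : M✶.closure {r} ⊆ M.E := by
  have := M✶.closure_subset_ground {r}
  rwa [Matroid.dual_ground] at this

/-- The class of a representative contains it. -/
theorem mem_cls_self {R : Set α} (hR : IsReps M R) {r : α} (hr : r ∈ R) : r ∈ M✶.closure {r} :=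
  M✶.mem_closure_self r (by rw [Matroid.dual_ground]; exact hR.subset hr)

/-- **Classes of distinct representatives are disjoint** (coloop-free). -/
theorem cls_disjoint (hcoloop : ∀ e, ¬ M.IsColoop e) {R : Set α} (hR : IsReps M R)
    {r s : α} (hr : r ∈ R) (hs : s ∈ R) (hne : r ≠ s) : Disjoint (M✶.closure {r}) (M✶.closure {s}) := by
  rw [Set.disjoint_left]
  intro y hyr hys
  have hyE : y ∈ M.E := cls_subset_ground M r hyr
  have hynl : M✶.IsNonloop y := dual_isNonloop_of_not_isColoop hcoloop hyE
  have h1 : M✶.closure {y} = M✶.closure {r} := hynl.closure_eq_of_mem_closure hyr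
  have h2 : M✶.closure {y} = M✶.closure {s} := hynl.closure_eq_of_mem_closure hys
  have hrs : r ∈ M✶.closure {s} := by
    rw [← h2, h1]; exact mem_cls_self hR hr
  exact hne (hR.inj r hr s hs hrs)

/-- Every element of `E` lies in the class of some representative (coloop-free). -/
theorem exists_mem_cls (hcoloop : ∀ e, ¬ M.IsColoop e) {R : Set α} (hR : IsReps M R) {e : α} (he : e ∈ M.E) :
    ∃ r ∈ R, e ∈ M✶.closure {r} :=
  hR.cover e (dual_isNonloop_of_not_isColoop hcoloop he)

/-- If `e` lies in the class of `r` then the two classes coincide (coloop-free). -/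
theorem cls_eq_of_mem (hcoloop : ∀ e, ¬ M.IsColoop e) {r e : α} (he : e ∈ M✶.closure {r}) :
    M✶.closure {e} = M✶.closure {r} :=
  (dual_isNonloop_of_not_isColoop hcoloop (cls_subset_ground M r he)).closure_eq_of_mem_closure he

/-- **A circuit is the union of the classes of its representatives.** -/
theorem isCircuit_eq_biUnion_cls [M.Finite] (hcoloop : ∀ e, ¬ M.IsColoop e) {R : Set α} (hR : IsReps M R)
    {C : Set α} (hC : M.IsCircuit C) : C = ⋃ r ∈ C ∩ R, M✶.closure {r} := by
  ext x
  simp only [Set.mem_iUnion, Set.mem_inter_iff, exists_prop]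
  constructor
  · intro hx
    obtain ⟨r, hr, hxr⟩ := exists_mem_cls hcoloop hR (hC.subset_ground hx)
    refine ⟨r, ⟨?_, hr⟩, hxr⟩
    -- `r ∈ cls r = cls x ⊆ C`
    have h := closure_dual_singleton_subset_of_mem_isCircuit hcoloop hC hx
    rw [cls_eq_of_mem hcoloop hxr] at h
    exact h (mem_cls_self hR hr)
  · rintro ⟨r, ⟨hrC, _⟩, hxr⟩
    exact closure_dual_singleton_subset_of_mem_isCircuit hcoloop hC hrC hxr

/-! ### Cardinalities -/

/-- The classes are finite. -/
theorem cls_finite [M.Finite] (r : α) : (M✶.closure {r}).Finite :=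
  M.ground_finite.subset (cls_subset_ground M r)

/-- The classes of the representatives in a finset `F ⊆ R` are pairwise disjoint (as finsets). -/
theorem pairwiseDisjoint_cls [M.Finite] (hcoloop : ∀ e, ¬ M.IsColoop e) {R : Set α} (hR : IsReps M R)
    {F : Finset α} (hF : ∀ r ∈ F, r ∈ R) :
    (↑F : Set α).PairwiseDisjoint (fun r => (cls_finite (M := M) r).toFinset) := by
  intro r hr s hs hne
  simp only [Function.onFun]
  rw [Set.Finite.disjoint_toFinset]
  exact cls_disjoint hcoloop hR (hF r hr) (hF s hs) hne

open Classical in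
/-- **`|C| = Σ_{r ∈ R ∩ C} |cls r|`** for a circuit `C`. -/
theorem ncard_isCircuit_eq_sum [M.Finite] (hcoloop : ∀ e, ¬ M.IsColoop e) {R : Set α} (hR : IsReps M R)
    (hRfin : R.Finite) {C : Set α} (hC : M.IsCircuit C) :
    C.ncard = ∑ r ∈ hRfin.toFinset.filter (· ∈ C), (M✶.closure {r}).ncard := by
  have hCeq : C = ↑((hRfin.toFinset.filter (· ∈ C)).biUnion (fun r => (cls_finite (M := M) r).toFinset)) := by
    ext x
    have hx := Set.ext_iff.1 (isCircuit_eq_biUnion_cls hcoloop hR hC) x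
    simp only [Set.mem_iUnion, Set.mem_inter_iff, exists_prop] at hx
    simp only [Finset.coe_biUnion, Finset.mem_coe, Set.Finite.mem_toFinset, Finset.coe_filter,
      Set.mem_setOf_eq, Set.mem_iUnion, exists_prop]
    rw [hx]
    constructor
    · rintro ⟨r, ⟨hrC, hrR⟩, hx⟩; exact ⟨r, ⟨hrR, hrC⟩, hx⟩
    · rintro ⟨r, ⟨hrR, hrC⟩, hx⟩; exact ⟨r, ⟨hrC, hrR⟩, hx⟩
  have hn : C.ncard = (↑((hRfin.toFinset.filter (· ∈ C)).biUnion (fun r => (cls_finite (M := M) r).toFinset)) :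
      Set (α)).ncard := congrArg Set.ncard hCeq
  rw [hn, Set.ncard_coe_finset, Finset.card_biUnion (pairwiseDisjoint_cls hcoloop hR
    (fun r hr => (Set.Finite.mem_toFinset _).1 (Finset.mem_filter.1 hr).1))]
  apply Finset.sum_congr rfl
  intro r _
  exact (Set.ncard_eq_toFinset_card _ _).symm

/-- **`|E| = Σ_{r ∈ R} |cls r|`** (coloop-free). -/
theorem ncard_ground_eq_sum [M.Finite] (hcoloop : ∀ e, ¬ M.IsColoop e) {R : Set α} (hR : IsReps M R)
    (hRfin : R.Finite) : M.E.ncard = ∑ r ∈ hRfin.toFinset, (M✶.closure {r}).ncard := by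
  classical
  have hEeq : M.E = ↑(hRfin.toFinset.biUnion (fun r => (cls_finite (M := M) r).toFinset)) := by
    ext x
    simp only [Finset.coe_biUnion, Finset.mem_coe, Set.Finite.mem_toFinset, Set.mem_iUnion, exists_prop]
    constructor
    · intro hx; exact exists_mem_cls hcoloop hR hx
    · rintro ⟨r, _, hx⟩; exact cls_subset_ground M r hx
  rw [hEeq, Set.ncard_coe_finset, Finset.card_biUnion (pairwiseDisjoint_cls hcoloop hR
    (fun r hr => (Set.Finite.mem_toFinset _).1 hr))]
  apply Finset.sum_congr rfl
  intro r _
  exact (Set.ncard_eq_toFinset_card _ _).symm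

/-- **`#{k-circuits} ≤ #{T ⊆ R : Σ_{r ∈ T} |cls r| = k}`**: `C ↦ R ∩ C` is injective on circuits. -/
theorem ncard_circuitsEq_le_card_weight [M.Finite] (hcoloop : ∀ e, ¬ M.IsColoop e) {R : Set α} (hR : IsReps M R)
    (hRfin : R.Finite) (k : ℕ) :
    (PercRepro.Matroid.circuitsEq M k).ncard ≤
      (hRfin.toFinset.powerset.filter (fun T => ∑ r ∈ T, (M✶.closure {r}).ncard = k)).card := by
  classical
  let f : Set α → Finset α := fun C => hRfin.toFinset.filter (· ∈ C)
  have hmaps : ∀ C ∈ PercRepro.Matroid.circuitsEq M k, f C ∈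
      (↑(hRfin.toFinset.powerset.filter (fun T => ∑ r ∈ T, (M✶.closure {r}).ncard = k)) : Set (Finset α)) := by
    rintro C ⟨hC, hCk⟩
    rw [Finset.mem_coe, Finset.mem_filter, Finset.mem_powerset]
    exact ⟨Finset.filter_subset _ _, by rw [← ncard_isCircuit_eq_sum hcoloop hR hRfin hC]; exact hCk⟩
  have hinj : Set.InjOn f (PercRepro.Matroid.circuitsEq M k) := by
    rintro C ⟨hC, _⟩ C' ⟨hC', _⟩ hf
    rw [isCircuit_eq_biUnion_cls hcoloop hR hC, isCircuit_eq_biUnion_cls hcoloop hR hC']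
    have hRC : C ∩ R = C' ∩ R := by
      ext r
      simp only [Set.mem_inter_iff]
      constructor
      · rintro ⟨hrC, hrR⟩
        have : r ∈ f C := Finset.mem_filter.2 ⟨(Set.Finite.mem_toFinset _).2 hrR, hrC⟩
        rw [hf] at this
        exact ⟨(Finset.mem_filter.1 this).2, hrR⟩
      · rintro ⟨hrC', hrR⟩
        have : r ∈ f C' := Finset.mem_filter.2 ⟨(Set.Finite.mem_toFinset _).2 hrR, hrC'⟩
        rw [← hf] at this
        exact ⟨(Finset.mem_filter.1 this).2, hrR⟩
    rw [hRC]
  have h := Set.ncard_le_ncard_of_injOn f hmaps hinj (Finset.finite_toSet _)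
  rwa [Set.ncard_coe_finset] at h

end CoreFour
end PercRepro
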